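/-
Copyright (c) 2026. All rights reserved.
Released under Apache 2.0 license as described in the file LICENSE.
Authors: abc-iut cell, Cor. 3.12 sub-crew seat abc-iut-c312-1 (gen 24).
-/
import Literature.IUT.LogVolume.LogUnitsTraceZeroDyadicSqrtNegOne
import Literature.IUT.LogVolume.TameRamificationIndex
import HarnessLib

/-!
# At `K ≅ ℚ₂(√−1)` the TRACE DETECTS THE TOP SHELL of `log₂(𝒪_K^×) = 𝔪³`: `z ≡ (Tr z/Tr ϖ³)·ϖ³ (mod 𝔪⁴)` for every unit logarithm `z`
# (classical 2-adic algebra; sequel of `LogUnitsTraceZeroDyadicSqrtNegOne`)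

abc-iut cell, PROOF-ONLY classical local algebra (Cor. 3.12 sub-crew, seat abc-iut-c312-1 gen 24, row «C:P2-PACKET-HULL-GAP», file 1/3; no
definition, no `Prop` fact, no instance, no notation).  Setting as in `LogUnitsTraceZeroDyadicSqrtNegOne`: a `2`-adic field `K` of the
campaign-S class with `i² = −1`, `(e, f) = (2, 1)` (`K ≅ ℚ₂(√−1)`, `log₂(𝒪_K^×) = 𝔪³`), `ϖ` a uniformizer (`‖ϖ‖² = 1/2`).

WHY (consumers: the packet file `TensorPacketTraceZeroDyadicSqrtNegOne` and `Summits/ABC/IUTFork/Thm311RealInd1StripPacketHullDyadic`): to carry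
«trace-zero unit logarithms are one shell short» (file 0) from one factor to a tensor packet `⊗_{ℚ₂} K_b` one needs the factorwise CONGRUENCE
form — every unit logarithm is its trace ratio times `ϖ³` up to the next shell — which multiplies across pure tensors.  THIS FILE:

* `norm_trace_le_of_mem_logUnits` — `‖Tr z‖ ≤ 1/4` on `log₂(𝒪^×) = 𝔪³` (`𝔪³ = 2·𝔪`, and the trace form is wild on the integers since `2 ∣ e`:
  `TameRamification.forall_norm_trace_lt_one_iff_dvd_absRamificationIdx`, so `Tr(𝒪) ⊆ 2ℤ₂`);
* **`norm_trace_uniformizer_pow_three`** — `‖Tr(ϖ³)‖ = 1/4` EXACTLY (were it `≤ 1/8`, `ϖ³ − (Tr ϖ³/8)·4` would be a trace-zero unit logarithm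
  of top norm `‖ϖ‖³`, against file 0's `norm_le_zpow_four_of_mem_logUnits_of_trace_eq_zero`); `trace_uniformizer_pow_three_ne_zero`;
  `norm_traceRatio_le_one` (`‖Tr z/Tr ϖ³‖ ≤ 1`);
* **`norm_sub_traceRatio_smul_le`** — THE CONGRUENCE: `‖z − (Tr z/Tr ϖ³)·ϖ³‖ ≤ ‖ϖ‖⁴` for every `z ∈ log₂(𝒪^×)` (the difference is a trace-zero
  unit logarithm); **`norm_eq_iff_norm_trace_eq`** — `‖z‖ = ‖ϖ‖³ ⟺ ‖Tr z‖ = ‖Tr ϖ³‖`: the trace detects the top shell.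
HONEST SCOPE: classical; the one field shape `(e, f) = (2, 1)` with `√−1`; nothing here mentions a hull, a packet, a log-volume or print's
indeterminacies; no side taken on [IUTchIII] Cor. 3.12; NO abc claim. [cite: NeukirchANT1999, Ch. II Prop. (5.5), (5.7)] [cite: SerreLocalFields1979,
Ch. III §3, Prop. 7; §6, Prop. 13]
-/

set_option autoImplicit false

noncomputable section

open Metric Set Module
open scoped Pointwise

namespace Literature.IUT.LogVolume

namespace TraceZeroDyadicSqrtNegOne

open Literature.NumberTheory.GaloisRepresentations.Ultrametric RamificationCriterion TameRamification

/-! ## §1 One factor `K ≅ ℚ₂(√−1)`: the trace detects the top shell of `log₂(𝒪^×) = 𝔪³` -/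

section OneFactor

variable {K : Type} [NontriviallyNormedField K] [NormedAlgebra ℚ_[2] K] [IsUltrametricDist K] [ProperSpace K]
  {ϖ : Kˣ} (hϖ : IsUniformizer ϖ)

/-- A `2`-adic number of norm `< 1` has norm `≤ 1/2`. [folklore] -/
private theorem padic_norm_le_half_of_norm_lt_one {a : ℚ_[2]} (ha : ‖a‖ < 1) : ‖a‖ ≤ 2⁻¹ := by
  have h := (Padic.norm_le_pow_iff_norm_lt_pow_add_one a (-1)).mpr (by simpa using ha)
  simpa using h

include hϖ in
/-- **`‖Tr z‖ ≤ 1/4` for `z ∈ log₂(𝒪_K^×) = 𝔪³`** at `K ≅ ℚ₂(√−1)`: `z = 2·y` with `‖y‖ ≤ ‖ϖ‖ ≤ 1`, and `‖Tr y‖ < 1` because `2 ∣ e = 2`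
(`forall_norm_trace_lt_one_iff_dvd_absRamificationIdx`: the trace form is wild on the integers), so `‖Tr y‖ ≤ 1/2`.
[cite: SerreLocalFields1979, Ch. III §6, Prop. 13] [cite: NeukirchANT1999, Ch. II Prop. (5.5)] -/
theorem norm_trace_le_of_mem_logUnits {i : K} (hi : i ^ 2 = -1) (he : absRamificationIdx 2 K = 2) (hf : residueDegree 2 K = 1)
    {z : K} (hz : z ∈ logUnits K) : ‖Algebra.trace ℚ_[2] K z‖ ≤ 2⁻¹ * 2⁻¹ := by
  have hρ0 : 0 < ‖(ϖ : K)‖ := norm_units_pos ϖ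
  have hz3 : ‖z‖ ≤ ‖(ϖ : K)‖ ^ (3 : ℕ) := by
    rw [DyadicNoFixedBall.logUnits_eq_closedBall_cube_of_sq_eq_neg_one hϖ hi he hf, mem_closedBall_zero_iff] at hz
    exact_mod_cast hz
  -- `y := 2⁻¹ • z` is an integer
  set y : K := (2 : ℚ_[2])⁻¹ • z with hy
  have hzy : z = (2 : ℚ_[2]) • y := by rw [hy, smul_smul, mul_inv_cancel₀ two_ne_zero, one_smul]
  have hy1 : ‖y‖ ≤ 1 := by
    have h2 : ‖(2 : ℚ_[2])‖ = 2⁻¹ := by simpa using Padic.norm_p (p := 2)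
    rw [hy, norm_smul, norm_inv, h2, inv_inv]
    calc 2 * ‖z‖ ≤ 2 * ‖(ϖ : K)‖ ^ 3 := mul_le_mul_of_nonneg_left hz3 (by norm_num)
      _ = ‖(ϖ : K)‖ := by rw [pow_succ, WildQuadraticDyadic.norm_unif_sq hϖ he]; ring
      _ ≤ 1 := hϖ.1.le
  have hwild := (forall_norm_trace_lt_one_iff_dvd_absRamificationIdx 2 K).mpr (by rw [he])
  have hTy : ‖Algebra.trace ℚ_[2] K y‖ ≤ 2⁻¹ := padic_norm_le_half_of_norm_lt_one (hwild y hy1)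
  have h2 : ‖(2 : ℚ_[2])‖ = 2⁻¹ := by simpa using Padic.norm_p (p := 2)
  rw [hzy, map_smul, smul_eq_mul, norm_mul, h2]
  exact mul_le_mul_of_nonneg_left hTy (by norm_num)

include hϖ in
/-- **`‖Tr(ϖ³)‖ = 1/4` EXACTLY** at `K ≅ ℚ₂(√−1)`: `≤` by the previous lemma; were `‖Tr ϖ³‖ ≤ 1/8`, the element `ϖ³ − (Tr ϖ³/8)·4` would be a
trace-zero (`Tr 4 = 8`) unit logarithm of norm `‖ϖ‖³` (`‖(Tr ϖ³/8)·4‖ ≤ ‖4‖ = ‖ϖ‖⁴ < ‖ϖ‖³`), contradicting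
`norm_le_zpow_four_of_mem_logUnits_of_trace_eq_zero`. [cite: NeukirchANT1999, Ch. II Prop. (5.5), (5.7)] [cite: SerreLocalFields1979, Ch. III §3, Prop. 7] -/
theorem norm_trace_uniformizer_pow_three {i : K} (hi : i ^ 2 = -1) (he : absRamificationIdx 2 K = 2) (hf : residueDegree 2 K = 1) :
    ‖Algebra.trace ℚ_[2] K ((ϖ : K) ^ 3)‖ = 2⁻¹ * 2⁻¹ := by
  have hρ0 : 0 < ‖(ϖ : K)‖ := norm_units_pos ϖ
  have hL : logUnits K = closedBall (0 : K) (‖(ϖ : K)‖ ^ 3) :=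
    DyadicNoFixedBall.logUnits_eq_closedBall_cube_of_sq_eq_neg_one hϖ hi he hf
  have hϖ3 : (ϖ : K) ^ 3 ∈ logUnits K := by rw [hL, mem_closedBall_zero_iff, norm_pow]
  refine le_antisymm (norm_trace_le_of_mem_logUnits hϖ hi he hf hϖ3) ?_
  by_contra hlt
  rw [not_le] at hlt
  set T : ℚ_[2] := Algebra.trace ℚ_[2] K ((ϖ : K) ^ 3) with hT
  -- `‖T‖ ≤ 1/8`
  have hT8 : ‖T‖ ≤ (2 : ℝ) ^ (-3 : ℤ) := by
    have h := (Padic.norm_le_pow_iff_norm_lt_pow_add_one T (-3)).mpr (by norm_num at hlt ⊢; exact hlt)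
    exact_mod_cast h
  have h2 : ‖(2 : ℚ_[2])‖ = 2⁻¹ := by simpa using Padic.norm_p (p := 2)
  have h8norm : ‖(8 : ℚ_[2])‖ = (2 : ℝ) ^ (-3 : ℤ) := by
    rw [show (8 : ℚ_[2]) = 2 ^ 3 by norm_num, norm_pow, h2]; norm_num
  have hfin : finrank ℚ_[2] K = 2 := finrank_eq_two_of_invariants he hf
  haveI : FiniteDimensional ℚ_[2] K := Module.finite_of_finrank_eq_succ hfin
  have hTr4 : Algebra.trace ℚ_[2] K (4 : K) = 8 := by
    rw [show (4 : K) = algebraMap ℚ_[2] K 4 by rw [map_ofNat], Algebra.trace_algebraMap, hfin]; norm_num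
  -- the witness
  set w : K := (ϖ : K) ^ 3 - (T / 8) • (4 : K) with hw
  have hwtr : Algebra.trace ℚ_[2] K w = 0 := by
    rw [hw, map_sub, map_smul, hTr4, smul_eq_mul, ← hT, div_mul_cancel₀ T (by norm_num), sub_self]
  have h4 : ‖(4 : K)‖ = ‖(ϖ : K)‖ ^ (4 : ℤ) := (zpow_four_eq_norm_four hϖ he).symm
  have hsmall : ‖(T / 8) • (4 : K)‖ < ‖(ϖ : K)‖ ^ 3 := by
    rw [norm_smul, h4]
    have h8 : ‖T / 8‖ ≤ 1 := by
      rw [norm_div, h8norm]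
      exact div_le_one_of_le₀ hT8 (by positivity)
    calc ‖T / 8‖ * ‖(ϖ : K)‖ ^ (4 : ℤ) ≤ 1 * ‖(ϖ : K)‖ ^ (4 : ℤ) :=
          mul_le_mul_of_nonneg_right h8 (zpow_nonneg hρ0.le _)
      _ < ‖(ϖ : K)‖ ^ 3 := by
          rw [one_mul, ← zpow_natCast, Nat.cast_ofNat]
          exact zpow_lt_zpow_right_of_lt_one₀ hρ0 hϖ.1 (by norm_num)
  have hwnorm : ‖w‖ = ‖(ϖ : K)‖ ^ 3 := by
    have hlt' : ‖-((T / 8) • (4 : K))‖ < ‖(ϖ : K) ^ 3‖ := by rw [norm_neg, norm_pow]; exact hsmall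
    have h := IsUltrametricDist.norm_add_eq_max_of_norm_ne_norm hlt'.ne'
    rw [← sub_eq_add_neg, max_eq_left hlt'.le, norm_pow] at h
    rw [hw, h]
  have hwL : w ∈ logUnits K := by rw [hL, mem_closedBall_zero_iff, hwnorm]
  have h := norm_le_zpow_four_of_mem_logUnits_of_trace_eq_zero hϖ hi he hf hwL hwtr
  rw [hwnorm, ← zpow_natCast, Nat.cast_ofNat] at h
  exact absurd h (not_le.mpr (zpow_lt_zpow_right_of_lt_one₀ hρ0 hϖ.1 (by norm_num)))

include hϖ in
/-- `Tr(ϖ³) ≠ 0`. [cite: NeukirchANT1999, Ch. II Prop. (5.5)] -/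
theorem trace_uniformizer_pow_three_ne_zero {i : K} (hi : i ^ 2 = -1) (he : absRamificationIdx 2 K = 2) (hf : residueDegree 2 K = 1) :
    Algebra.trace ℚ_[2] K ((ϖ : K) ^ 3) ≠ 0 := by
  intro h
  have h' := norm_trace_uniformizer_pow_three hϖ hi he hf
  rw [h, norm_zero] at h'
  norm_num at h'

include hϖ in
/-- **The trace ratio is integral**: `‖Tr z / Tr ϖ³‖ ≤ 1` for `z ∈ log₂(𝒪_K^×)`. [cite: NeukirchANT1999, Ch. II Prop. (5.5)] -/
theorem norm_traceRatio_le_one {i : K} (hi : i ^ 2 = -1) (he : absRamificationIdx 2 K = 2) (hf : residueDegree 2 K = 1)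
    {z : K} (hz : z ∈ logUnits K) :
    ‖Algebra.trace ℚ_[2] K z / Algebra.trace ℚ_[2] K ((ϖ : K) ^ 3)‖ ≤ 1 := by
  rw [norm_div, norm_trace_uniformizer_pow_three hϖ hi he hf]
  exact div_le_one_of_le₀ (norm_trace_le_of_mem_logUnits hϖ hi he hf hz) (by norm_num)

include hϖ in
/-- **THE TRACE DETECTS THE TOP SHELL (congruence form).**  At `K ≅ ℚ₂(√−1)` every unit logarithm `z ∈ log₂(𝒪_K^×) = 𝔪³` satisfies
`‖z − (Tr z / Tr ϖ³)·ϖ³‖ ≤ ‖ϖ‖⁴`: the difference is a trace-zero unit logarithm (`‖(Tr z/Tr ϖ³)·ϖ³‖ ≤ ‖ϖ‖³`), hence one shell down by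
`norm_le_zpow_four_of_mem_logUnits_of_trace_eq_zero`. [cite: NeukirchANT1999, Ch. II Prop. (5.5), (5.7)] [cite: SerreLocalFields1979, Ch. III §3, Prop. 7] -/
theorem norm_sub_traceRatio_smul_le {i : K} (hi : i ^ 2 = -1) (he : absRamificationIdx 2 K = 2) (hf : residueDegree 2 K = 1)
    {z : K} (hz : z ∈ logUnits K) :
    ‖z - (Algebra.trace ℚ_[2] K z / Algebra.trace ℚ_[2] K ((ϖ : K) ^ 3)) • (ϖ : K) ^ 3‖ ≤ ‖(ϖ : K)‖ ^ (4 : ℤ) := by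
  have hL : logUnits K = closedBall (0 : K) (‖(ϖ : K)‖ ^ 3) :=
    DyadicNoFixedBall.logUnits_eq_closedBall_cube_of_sq_eq_neg_one hϖ hi he hf
  set t : ℚ_[2] := Algebra.trace ℚ_[2] K z / Algebra.trace ℚ_[2] K ((ϖ : K) ^ 3) with ht
  have htL : t • (ϖ : K) ^ 3 ∈ logUnits K := by
    rw [hL, mem_closedBall_zero_iff, norm_smul, norm_pow]
    calc ‖t‖ * ‖(ϖ : K)‖ ^ 3 ≤ 1 * ‖(ϖ : K)‖ ^ 3 :=
        mul_le_mul_of_nonneg_right (norm_traceRatio_le_one hϖ hi he hf hz) (pow_nonneg (norm_nonneg _) _)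
      _ = ‖(ϖ : K)‖ ^ 3 := one_mul _
  have hsubL : z - t • (ϖ : K) ^ 3 ∈ logUnits K :=
    (logUnitsAddSubgroup 2 K).sub_mem (show z ∈ logUnitsAddSubgroup 2 K from hz) (show t • (ϖ : K) ^ 3 ∈ logUnitsAddSubgroup 2 K from htL)
  have htr : Algebra.trace ℚ_[2] K (z - t • (ϖ : K) ^ 3) = 0 := by
    rw [map_sub, map_smul, smul_eq_mul, ht, div_mul_cancel₀ _ (trace_uniformizer_pow_three_ne_zero hϖ hi he hf), sub_self]
  exact norm_le_zpow_four_of_mem_logUnits_of_trace_eq_zero hϖ hi he hf hsubL htr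

include hϖ in
/-- **Top shell ⟺ unit trace ratio**: for `z ∈ log₂(𝒪_K^×)`, `‖z‖ = ‖ϖ‖³` iff `‖Tr z‖ = ‖Tr ϖ³‖` (`= 1/4`); otherwise `‖z‖ ≤ ‖ϖ‖⁴` and
`‖Tr z‖ ≤ 1/8`. [cite: NeukirchANT1999, Ch. II Prop. (5.5), (5.7)] -/
theorem norm_eq_iff_norm_trace_eq {i : K} (hi : i ^ 2 = -1) (he : absRamificationIdx 2 K = 2) (hf : residueDegree 2 K = 1)
    {z : K} (hz : z ∈ logUnits K) :
    ‖z‖ = ‖(ϖ : K)‖ ^ 3 ↔ ‖Algebra.trace ℚ_[2] K z‖ = ‖Algebra.trace ℚ_[2] K ((ϖ : K) ^ 3)‖ := by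
  have hρ0 : 0 < ‖(ϖ : K)‖ := norm_units_pos ϖ
  have hT0 := trace_uniformizer_pow_three_ne_zero hϖ hi he hf
  have h43 : ‖(ϖ : K)‖ ^ (4 : ℤ) < ‖(ϖ : K)‖ ^ 3 := by
    rw [← zpow_natCast, Nat.cast_ofNat]; exact zpow_lt_zpow_right_of_lt_one₀ hρ0 hϖ.1 (by norm_num)
  set t : ℚ_[2] := Algebra.trace ℚ_[2] K z / Algebra.trace ℚ_[2] K ((ϖ : K) ^ 3) with ht
  have hcong := norm_sub_traceRatio_smul_le hϖ hi he hf hz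
  have ht1 : ‖t‖ ≤ 1 := norm_traceRatio_le_one hϖ hi he hf hz
  have hts : ‖t • (ϖ : K) ^ 3‖ = ‖t‖ * ‖(ϖ : K)‖ ^ 3 := by rw [norm_smul, norm_pow]
  have hiff : ‖Algebra.trace ℚ_[2] K z‖ = ‖Algebra.trace ℚ_[2] K ((ϖ : K) ^ 3)‖ ↔ ‖t‖ = 1 := by
    rw [ht, norm_div, div_eq_one_iff_eq (norm_ne_zero_iff.mpr hT0)]
  rw [hiff]
  constructor
  · intro hz3
    by_contra ht1'
    have htlt : ‖t‖ < 1 := lt_of_le_of_ne ht1 ht1'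
    have ht2 : ‖t‖ ≤ 2⁻¹ := padic_norm_le_half_of_norm_lt_one htlt
    -- then `‖z‖ ≤ max ‖z − t ϖ³‖ ‖t ϖ³‖ < ‖ϖ‖³`
    have hsm : ‖t • (ϖ : K) ^ 3‖ < ‖(ϖ : K)‖ ^ 3 := by
      rw [hts]
      calc ‖t‖ * ‖(ϖ : K)‖ ^ 3 ≤ 2⁻¹ * ‖(ϖ : K)‖ ^ 3 := mul_le_mul_of_nonneg_right ht2 (pow_nonneg (norm_nonneg _) _)
        _ < 1 * ‖(ϖ : K)‖ ^ 3 := mul_lt_mul_of_pos_right (by norm_num) (pow_pos hρ0 _)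
        _ = _ := one_mul _
    have : ‖z‖ < ‖(ϖ : K)‖ ^ 3 := by
      have h := IsUltrametricDist.norm_add_le_max (z - t • (ϖ : K) ^ 3) (t • (ϖ : K) ^ 3)
      rw [sub_add_cancel] at h
      exact h.trans_lt (max_lt (hcong.trans_lt h43) hsm)
    exact absurd hz3 this.ne
  · intro ht1e
    have hts' : ‖t • (ϖ : K) ^ 3‖ = ‖(ϖ : K)‖ ^ 3 := by rw [hts, ht1e, one_mul]
    have hlt : ‖z - t • (ϖ : K) ^ 3‖ < ‖t • (ϖ : K) ^ 3‖ := by rw [hts']; exact hcong.trans_lt h43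
    have h := IsUltrametricDist.norm_add_eq_max_of_norm_ne_norm hlt.ne
    rw [sub_add_cancel, max_eq_right hlt.le, hts'] at h
    exact h

end OneFactor

end TraceZeroDyadicSqrtNegOne

end Literature.IUT.LogVolume

end
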